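import Summits.NavierStokesRegularity.NavierStokesRegularity.Theses.AxisymmetricExtremality
import Summits.NavierStokesRegularity.NavierStokesRegularity.Theorems.AxisymmetricExtremalityAxisymmetricKatoGlobalNoSwirlStratum
import Literature.Analysis.FluidPDE.AxisymmetricReflection
import Literature.Analysis.FluidPDE.SereginSverakAxisymmetric
import Literature.Analysis.FluidPDE.SuitableWeak

/-!
# Strategist sketch (unit cstrat-stmt-NavierStokesRegularity-15453-s20-g22, census family `s`)

Kernel-checked bookkeeping behind `STRATEGY-CENSUS-s20.md` (independent census) for the crux
`AxisymmetricExtremality.AxisymmetricKatoGlobal` (stmt-NavierStokesRegularity-15453).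

* `NoAxisymMinimalBlowupDatum` (W1) — the THRESHOLD INSTANCE of the crux, i.e. exactly what the
  route's deciding theorem `closes` consumes; `closes_threshold` re-proves `closes` from it and
  `noAxisymMinimalBlowupDatum_of_crux` shows it is formally weaker than the crux.
* `noO2MinimalBlowupDatum` (W2) — the O(2)-symmetric threshold instance (axisymmetric AND
  equivariant under the meridian reflection `reflY`) is a THEOREM of the tree: such a datum has no
  swirl (`IsAxisymmetric.hasNoSwirl_of_reflY_eq`) and swirl-free axisymmetric `L³` data are global
  for every `ν > 0` (`hasGlobalKatoSolution_of_isAxisymmetric_hasNoSwirl_viscosity`).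
* `MinimalDatumDihedral`, `DihedralToO2`, `closes_O2` — the ROUTE-LEVEL re-typing under which W2
  replaces the crux entirely: dihedral (`D_p = ⟨R_{2π/p}, σ⟩`) instead of cyclic (`Z_p`) symmetric
  minimal blow-up data, upgraded by compactness to `O(2)`-symmetric ones. `closes_O2` is sorry-free;
  its two hypotheses are the analogues of the sibling cruxes `MinimalDatumPFold` (open) and
  `PFoldToAxisymmetric` (proved). This seat may not open or re-glue routes (`no_new_routes`); the
  census records the recommendation for the tenure planner.

Nothing here claims the crux; no `sorry`.
-/

noncomputable section

open MeasureTheory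
open Literature.Analysis.FluidPDE
open Literature.Analysis.FunctionSpaces

namespace Summit.NavierStokesRegularity.NavierStokesRegularity.Cruxes.AxisymmetricKatoGlobal.StrategistS20g22

open Summit.NavierStokesRegularity.NavierStokesRegularity.Theses.AxisymmetricExtremality
open Summit.NavierStokesRegularity.NavierStokesRegularity.Theorems.AxisymmetricKatoGlobal.NoSwirlStratum

local notation "ℝ³" => EuclideanSpace ℝ (Fin 3)
local notation "ℂ³" => EuclideanSpace ℂ (Fin 3)

/-- The Clay blow-up hypothesis at viscosity `ν` (a smooth, divergence-free, rapidly decaying datum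
without a smooth bounded-energy solution), spelled exactly as in `MinimalDatumPFold`. -/
def ClayBlowupAt (ν : ℝ) : Prop :=
  ∃ v₀ : ℝ³ → ℝ³, ContDiff ℝ (⊤ : ℕ∞) v₀ ∧ NSWave0.IsDivFree v₀ ∧ HasRapidSpatialDecay v₀ ∧
    ¬ ∃ (u : ℝ → ℝ³ → ℝ³) (p : ℝ → ℝ³ → ℝ), IsSmoothOnHalfSpace u ∧ IsSmoothOnHalfSpace p ∧
      IsNavierStokesSolution ν 0 v₀ u p ∧ HasBoundedEnergy u

/-! ## W1 — the threshold instance of the crux -/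

/-- **W1.** No axisymmetric `Ḣ^{1/2}`-minimal blow-up datum, for any `ν > 0`. This is the only
instance of `AxisymmetricKatoGlobal` that `closes` uses. -/
def NoAxisymMinimalBlowupDatum : Prop :=
  ∀ ν : ℝ, 0 < ν → ∀ (u₀ : ℝ³ → ℝ³) (g : HomSobolev ℝ³ ℂ³ (1 / 2 : ℝ)),
    IsMinimalBlowupDatum ν u₀ g → IsAxisymmetric u₀ → False

/-- The crux implies its threshold instance (formal weakening). -/
theorem noAxisymMinimalBlowupDatum_of_crux (h : AxisymmetricKatoGlobal) :
    NoAxisymMinimalBlowupDatum := by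
  intro ν hν u₀ g hmin hax
  obtain ⟨hL3, hrep, hdiv, -, hnot⟩ := hmin
  exact hnot (h ν hν u₀ g hL3 hrep hdiv (fun θ x => hax θ x))

/-- `closes` re-proved with W1 in place of the crux: the route's deciding theorem consumes only the
threshold instance. -/
theorem closes_threshold (h₂ : MinimalDatumPFold) (h₄ : PFoldToAxisymmetric)
    (hW : NoAxisymMinimalBlowupDatum) : NavierStokesRegularity := by
  show Literature.NS.NavierStokesExistenceSmoothR3
  intro ν hν u₀ hsm hdiv hdec
  by_contra hno
  obtain ⟨u₁, g, hmin, hax⟩ := h₄ ν hν (h₂ ν hν ⟨u₀, hsm, hdiv, hdec, hno⟩)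
  exact hW ν hν u₁ g hmin (fun θ x => hax θ x)

/-! ## W2 — the O(2)-symmetric threshold instance is a theorem -/

/-- **W2 (theorem).** There is no `Ḣ^{1/2}`-minimal blow-up datum which is axisymmetric AND
equivariant under the meridian reflection `σ = reflY : (x₀,x₁,x₂) ↦ (x₀,−x₁,x₂)`: such a field has
no swirl, and swirl-free axisymmetric weakly divergence-free `L³` data have global Kato solutions
for every `ν > 0`. -/
theorem noO2MinimalBlowupDatum :
    ∀ ν : ℝ, 0 < ν → ∀ (u₀ : ℝ³ → ℝ³) (g : HomSobolev ℝ³ ℂ³ (1 / 2 : ℝ)),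
      IsMinimalBlowupDatum ν u₀ g → IsAxisymmetric u₀ → (∀ x, u₀ (reflY x) = reflY (u₀ x)) →
        False := by
  intro ν hν u₀ g hmin hax hσ
  obtain ⟨hL3, -, hdiv, -, hnot⟩ := hmin
  exact hnot (hasGlobalKatoSolution_of_isAxisymmetric_hasNoSwirl_viscosity hν hL3 hdiv hax
    (hax.hasNoSwirl_of_reflY_eq hσ))

/-- W2 is an instance of W1's pattern: W1 implies it (trivially), recorded for the census table. -/
theorem noO2_of_noAxisym (h : NoAxisymMinimalBlowupDatum) :
    ∀ ν : ℝ, 0 < ν → ∀ (u₀ : ℝ³ → ℝ³) (g : HomSobolev ℝ³ ℂ³ (1 / 2 : ℝ)),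
      IsMinimalBlowupDatum ν u₀ g → IsAxisymmetric u₀ → (∀ x, u₀ (reflY x) = reflY (u₀ x)) →
        False :=
  fun ν hν u₀ g hmin hax _ => h ν hν u₀ g hmin hax

/-! ## Route-level re-typing under which W2 replaces the crux -/

/-- **Dihedral analogue of `MinimalDatumPFold`.** If a Clay datum blows up at viscosity `ν`, then
for unboundedly many `p ≥ 2` there is an `Ḣ^{1/2}`-minimal blow-up datum equivariant under the
dihedral group `D_p = ⟨R_{2π/p}, σ⟩` (rotation by `2π/p` about the `x₂`-axis and the meridian
reflection `σ = reflY`). Intended mechanism: as for `MinimalDatumPFold` (P. A. Smith fixed points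
on the compact Sim-quotient `M̂` of minimal data) with the `2`-groups `D_{2^k}` in place of `Z_p`;
needs the same `F₂`-acyclicity input. OPEN (same status as `MinimalDatumPFold`). -/
def MinimalDatumDihedral : Prop :=
  ∀ ν : ℝ, 0 < ν → ClayBlowupAt ν → ∀ N : ℕ, ∃ p : ℕ, N ≤ p ∧ 2 ≤ p ∧
    ∃ (u₀ : ℝ³ → ℝ³) (g : HomSobolev ℝ³ ℂ³ (1 / 2 : ℝ)), IsMinimalBlowupDatum ν u₀ g ∧
      (∀ x, u₀ (rotZ (2 * Real.pi / p) x) = rotZ (2 * Real.pi / p) (u₀ x)) ∧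
      (∀ x, u₀ (reflY x) = reflY (u₀ x))

/-- **Dihedral analogue of `PFoldToAxisymmetric` (compactness upgrade).** `D_p`-symmetric minimal
blow-up data for unboundedly many `p` yield an `O(2)`-symmetric one (axisymmetric and
`σ`-equivariant): modulate by Rusin–Šverák compactness exactly as in the PROVED
`axisymmetricExtremality_pFoldToAxisymmetric_proof`, carrying the closed condition
`u (σ x) = σ (u x)` through the `Ḣ^{1/2}`-limit. Expected difficulty: M (adaptation of a landed proof). -/
def DihedralToO2 : Prop :=
  ∀ ν : ℝ, 0 < ν → (∀ N : ℕ, ∃ p : ℕ, N ≤ p ∧ 2 ≤ p ∧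
    ∃ (u₀ : ℝ³ → ℝ³) (g : HomSobolev ℝ³ ℂ³ (1 / 2 : ℝ)), IsMinimalBlowupDatum ν u₀ g ∧
      (∀ x, u₀ (rotZ (2 * Real.pi / p) x) = rotZ (2 * Real.pi / p) (u₀ x)) ∧
      (∀ x, u₀ (reflY x) = reflY (u₀ x))) →
    ∃ (u₀ : ℝ³ → ℝ³) (g : HomSobolev ℝ³ ℂ³ (1 / 2 : ℝ)), IsMinimalBlowupDatum ν u₀ g ∧
      IsAxisymmetric u₀ ∧ (∀ x, u₀ (reflY x) = reflY (u₀ x))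

/-- **Route-level bypass, kernel-checked.** With dihedral instead of cyclic symmetry the third
hypothesis of `closes` (the crux `AxisymmetricKatoGlobal`) disappears: `W2` closes the argument. -/
theorem closes_O2 (hD : MinimalDatumDihedral) (hC : DihedralToO2) : NavierStokesRegularity := by
  show Literature.NS.NavierStokesExistenceSmoothR3
  intro ν hν u₀ hsm hdiv hdec
  by_contra hno
  obtain ⟨u₁, g, hmin, hax, hσ⟩ := hC ν hν (hD ν hν ⟨u₀, hsm, hdiv, hdec, hno⟩)
  exact noO2MinimalBlowupDatum ν hν u₁ g hmin hax hσ

/-- Sanity link: the cyclic hypothesis of the live route is implied by the dihedral one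
(forgetting `σ`), so `MinimalDatumDihedral` is a STRENGTHENING of `MinimalDatumPFold`, not a
weakening — the price of removing the crux is paid on the sibling crux. -/
theorem minimalDatumPFold_of_dihedral (hD : MinimalDatumDihedral) : MinimalDatumPFold := by
  intro ν hν hclay N
  obtain ⟨p, hNp, h2p, u₀, g, hmin, hrot, -⟩ := hD ν hν hclay N
  exact ⟨p, hNp, h2p, u₀, g, hmin, fun x => hrot x⟩


/-! ## S⁺ — the strengthen-lens candidate, typed (census heading `## Strengthen`) -/

/-- **S⁺ (local axis regularity; the classical axisymmetric regularity conjecture in its local,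
suitable-weak form).** Every axisymmetric suitable weak solution of Navier–Stokes (`ν = 1`, no
force) in the unit parabolic cylinder `Q = 𝒞 × ]-1,0[` is regular at the origin. Strictly stronger
than the open core of the crux (it implies `AxisymmetricKatoGlobal` through the LANDED
normalisation chain `stub_katoAxisymSingularPoint` ↦ singular axis point ↦ local suitable solution
about it, exactly as the registered line feeds Seregin's 2022 criterion); recorded here only as the
typed signature the census discusses — no claim. Known cases: Type I (`SereginSverak2009`,
`isRegularAtOrigin_of_typeI`), log-small swirl (`seregin2022_logSwirl_regularAtOrigin_holds`). -/
def LocalAxisRegularity : Prop :=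
  ∀ (u : ℝ → ℝ³ → ℝ³) (p : ℝ → ℝ³ → ℝ),
    SereginSverak2009.IsAxisymmetricLocalSolution u p →
    IsSuitableWeakSolutionOn (SereginSverak2009.parCylOpens 0 1) 1 0 u p →
    SereginSverak2009.IsRegularAtOrigin u

end Summit.NavierStokesRegularity.NavierStokesRegularity.Cruxes.AxisymmetricKatoGlobal.StrategistS20g22

end
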